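/-
Copyright: the b2b-balaban T⁴-continuum CRUX team, row NE7b OWNER lineage `t4-ne7b-p1` (gen 142). Project licence.
-/
import Summits.QuantumFields.BalabanUV.T4Continuum.Spine.NE7b.SupTruncationSingleCut

/-!
# TRUNCATION AT ORDER FIVE: THE SMALL MOMENT PIECES (SCOPING (d14)(2)(ii), third analytic order-five file).  The two order-five cut bounds
# (next file) decompose, after clamping every factor ((541)∕(542)),
#   `1|4`:  `E[f₁⋯f₅] = (E[Π f] − E[Π T_Rf]) + Cov(T_Rf₁, ΠT_Rf_{2..5}) + E[T_Rf₁]·E[ΠT_Rf_{2..5}]`,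
#   `2|3`:  `E[Πf] − E[f₁f₂]E[f₃f₄f₅] = (E[Πf] − E[ΠT_Rf]) + Cov(T_Rf₁T_Rf₂, T_Rf₃T_Rf₄T_Rf₅) + (E[T_Rf₁T_Rf₂]E[ΠT_Rf_{3..5}] − E[f₁f₂]E[f₃f₄f₅])`,
# and besides (541)'s five-factor defect and re-centring cost and (486)'s pair pieces one needs the CLAMPED QUADRUPLE and TRIPLE moments and
# the pure TRIPLE defect — all with fourth moments only:
#   `|E[T_RfT_RgT_RhT_Rk]| ≤ ΣE[f⁴]∕4`,  `|E[T_RfT_RgT_Rh]| ≤ (E[f²] + (E[g⁴]+E[h⁴])∕2)∕2`,  `|E[fgh] − E[T_RfT_RgT_Rh]| ≤ (E[f⁴]+E[g⁴]+E[h⁴])∕R`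
# (row NE7b, node U5c; (486) `abs_quad_le`, `integrable_quad_clamped`, `integrable_sq_of_quartic`, (490) `triple_sub_clamp_triple_abs_le` BY NAME;
# Mathlib measure theory; [folklore])

Cell `pub-balaban`, sub-cell `t4`, spine estimate NE7b (`T4WeightBudget.RelWeightBound`; the cell's OWN estimate — NOT PRINTED in
[Bałaban 1983–89], NOT PROVED).  Crux-route work under `Spine/NE7b/` by the row OWNER (`t4-ne7b-p1` gen 142, file (543)) under FREEZE
(0)'s crux-prover clause; NOTHING of Bałaban's is named as a Lean object, valued or asserted; no `T4Continuum/Support` leaf typed; no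
`def`, no notation (the clamp WRITTEN OUT); zero `sorry`.  Imports (BY NAME): the OWNER's (490) `…SupTruncationSingleCut` (`triple_sub_clamp_triple_abs_le`;
through it (486) `SupTruncationGroupBound.*`).

WHAT IS PROVED ([folklore]; probability measure, fourth moments integrable): §1 `sq_mul_abs_two_le`, `abs_triple_le'`; §2 `integrable_triple'`,
`integrable_triple_clamped'`, **`abs_expect_clamped_quad_le`**, **`abs_expect_clamped_triple_le`**, **`triple_expect_defect_le`**; §3 toy.

HONEST (what this is NOT).  Moment bookkeeping only; the two Gibbs-format cut bounds, their fifteen instantiations, the whitened fifth cumulant and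
its kernel letter are the next files; scalar skeleton ((A3), NC-NE7b-α UNRULED); nothing of Bałaban's asserted.  BY-NAME EFFECT ON THE WALL: NONE.
NE7b NOT PRINTED ∕ NOT PROVED; spine PROVED 0∕9; rung (B)+1 — FINITE-torus statements; NOT the mass gap, NOT Clay.  HONEST DEPENDENCY: continuum
YM on T⁴ ⇐ BetaPertH ∧ nine spine estimates (0∕9 proved); BetaPertH ⇐ (D1) ∧ (D4) ∧ CAP+tail; G-an2-4 gates asym, D1 and NE2∕3∕4.
-/

set_option autoImplicit false

noncomputable section

namespace Summit.QuantumFields.BalabanUV.T4Continuum.NE7b.SupTruncationFiveMoments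

open MeasureTheory Real
open SupTruncationGroupBound (abs_quad_le integrable_quad_clamped integrable_sq_of_quartic)
open SupTruncationSingleCut (triple_sub_clamp_triple_abs_le)

/-! ## §1. Pointwise inequalities -/

/-- `x²|y||z| ≤ x⁴∕2 + (y⁴ + z⁴)∕4`. [folklore] -/
theorem sq_mul_abs_two_le (x y z : ℝ) : x ^ 2 * |y| * |z| ≤ x ^ 4 / 2 + (y ^ 4 + z ^ 4) / 4 := by
  have h1 : x ^ 2 * (|y| * |z|) ≤ (x ^ 4 + (|y| * |z|) ^ 2) / 2 := by nlinarith [sq_nonneg (x ^ 2 - |y| * |z|)]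
  have h2 : (|y| * |z|) ^ 2 ≤ (y ^ 4 + z ^ 4) / 2 := by
    have e : (|y| * |z|) ^ 2 = y ^ 2 * z ^ 2 := by rw [mul_pow, sq_abs, sq_abs]
    rw [e]; nlinarith [sq_nonneg (y ^ 2 - z ^ 2)]
  calc x ^ 2 * |y| * |z| = x ^ 2 * (|y| * |z|) := by ring
    _ ≤ x ^ 4 / 2 + (y ^ 4 + z ^ 4) / 4 := by linarith

/-- `|abc| ≤ (a² + (b⁴ + c⁴)∕2)∕2`. [folklore] -/
theorem abs_triple_le' (a b c : ℝ) : |a * b * c| ≤ (a ^ 2 + (b ^ 4 + c ^ 4) / 2) / 2 := by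
  rw [abs_mul, abs_mul]
  have h1 : |a| * (|b| * |c|) ≤ (|a| ^ 2 + (|b| * |c|) ^ 2) / 2 := by nlinarith [sq_nonneg (|a| - |b| * |c|)]
  have h2 : (|b| * |c|) ^ 2 ≤ (b ^ 4 + c ^ 4) / 2 := by
    have e : (|b| * |c|) ^ 2 = b ^ 2 * c ^ 2 := by rw [mul_pow, sq_abs, sq_abs]
    rw [e]; nlinarith [sq_nonneg (b ^ 2 - c ^ 2)]
  rw [sq_abs] at h1
  calc |a| * |b| * |c| = |a| * (|b| * |c|) := by ring
    _ ≤ (a ^ 2 + (b ^ 4 + c ^ 4) / 2) / 2 := by linarith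

/-! ## §2. Expectations under a probability measure -/

variable {Ω : Type*} [MeasurableSpace Ω] {μ : Measure Ω} {f g h k : Ω → ℝ}

/-- **`fgh` is integrable** (fourth moments; dominated by `(f² + (g⁴+h⁴)/2)/2`). [folklore] -/
theorem integrable_triple' [IsProbabilityMeasure μ] (hf : Measurable f) (hg : Measurable g) (hh : Measurable h)
    (hf4 : Integrable (fun ω => f ω ^ 4) μ) (hg4 : Integrable (fun ω => g ω ^ 4) μ) (hh4 : Integrable (fun ω => h ω ^ 4) μ) :
    Integrable (fun ω => f ω * g ω * h ω) μ := by
  have hf2 := integrable_sq_of_quartic hf hf4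
  refine ((hf2.add ((hg4.add hh4).div_const 2)).div_const 2).mono' ((hf.mul hg).mul hh).aestronglyMeasurable (ae_of_all _ fun ω => ?_)
  rw [Real.norm_eq_abs]
  simpa using abs_triple_le' (f ω) (g ω) (h ω)

/-- **The clamped triple `T_Rf·T_Rg·T_Rh` is integrable** (`R ≥ 0`). [folklore] -/
theorem integrable_triple_clamped' [IsProbabilityMeasure μ] (hf : Measurable f) (hg : Measurable g) (hh : Measurable h) {R : ℝ} (hR : 0 ≤ R)
    (hf4 : Integrable (fun ω => f ω ^ 4) μ) (hg4 : Integrable (fun ω => g ω ^ 4) μ) (hh4 : Integrable (fun ω => h ω ^ 4) μ) :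
    Integrable (fun ω => max (-R) (min R (f ω)) * max (-R) (min R (g ω)) * max (-R) (min R (h ω))) μ := by
  have hm : ∀ {φ : Ω → ℝ}, Measurable φ → Measurable fun ω => max (-R) (min R (φ ω)) := fun hφ => measurable_const.max (measurable_const.min hφ)
  have hshrink : ∀ w : ℝ, |max (-R) (min R w)| ≤ |w| := fun w => by
    rcases le_or_gt w (-R) with h1 | h1
    · rw [min_eq_right (by linarith), max_eq_left h1, abs_of_nonpos (by linarith), abs_of_nonpos (by linarith)]; linarith
    · rcases le_or_gt w R with h2 | h2
      · rw [min_eq_right h2, max_eq_right h1.le]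
      · rw [min_eq_left h2.le, max_eq_right (by linarith), abs_of_nonneg hR, abs_of_pos (by linarith)]; linarith
  have hf2 := integrable_sq_of_quartic hf hf4
  refine ((hf2.add ((hg4.add hh4).div_const 2)).div_const 2).mono' (((hm hf).mul (hm hg)).mul (hm hh)).aestronglyMeasurable
    (ae_of_all _ fun ω => ?_)
  rw [Real.norm_eq_abs, abs_mul, abs_mul]
  have hq := abs_triple_le' (f ω) (g ω) (h ω)
  rw [abs_mul, abs_mul] at hq
  have hprod : |max (-R) (min R (f ω))| * |max (-R) (min R (g ω))| * |max (-R) (min R (h ω))| ≤ |f ω| * |g ω| * |h ω| :=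
    mul_le_mul (mul_le_mul (hshrink _) (hshrink _) (abs_nonneg _) (abs_nonneg _)) (hshrink _) (abs_nonneg _) (by positivity)
  simpa using hprod.trans hq

/-- **The clamped quadruple moment**: `|∫T_RfT_RgT_RhT_Rk| ≤ (∫f⁴ + ∫g⁴ + ∫h⁴ + ∫k⁴)∕4` (`R ≥ 0`). [folklore] -/
theorem abs_expect_clamped_quad_le [IsProbabilityMeasure μ] {R : ℝ} (hR : 0 ≤ R) (hf4 : Integrable (fun ω => f ω ^ 4) μ) (hg4 : Integrable (fun ω =>
    g ω ^ 4) μ) (hh4 : Integrable (fun ω => h ω ^ 4) μ)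
    (hk4 : Integrable (fun ω => k ω ^ 4) μ) :
    |∫ ω, max (-R) (min R (f ω)) * max (-R) (min R (g ω)) * max (-R) (min R (h ω)) * max (-R) (min R (k ω)) ∂μ| ≤
      ((∫ ω, f ω ^ 4 ∂μ) + (∫ ω, g ω ^ 4 ∂μ) + (∫ ω, h ω ^ 4 ∂μ) + (∫ ω, k ω ^ 4 ∂μ)) / 4 := by
  have hshrink : ∀ w : ℝ, |max (-R) (min R w)| ≤ |w| := fun w => by
    rcases le_or_gt w (-R) with h1 | h1
    · rw [min_eq_right (by linarith), max_eq_left h1, abs_of_nonpos (by linarith), abs_of_nonpos (by linarith)]; linarith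
    · rcases le_or_gt w R with h2 | h2
      · rw [min_eq_right h2, max_eq_right h1.le]
      · rw [min_eq_left h2.le, max_eq_right (by linarith), abs_of_nonneg hR, abs_of_pos (by linarith)]; linarith
  have h4a : Integrable (fun ω => f ω ^ 4 + g ω ^ 4) μ := hf4.add hg4
  have h4b : Integrable (fun ω => f ω ^ 4 + g ω ^ 4 + h ω ^ 4) μ := h4a.add hh4
  have h4c : Integrable (fun ω => f ω ^ 4 + g ω ^ 4 + h ω ^ 4 + k ω ^ 4) μ := h4b.add hk4
  have hb : Integrable (fun ω => (f ω ^ 4 + g ω ^ 4 + h ω ^ 4 + k ω ^ 4) / 4) μ := h4c.div_const 4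
  refine (abs_integral_le_integral_abs).trans ((integral_mono_of_nonneg (ae_of_all _ fun ω => abs_nonneg _) hb
    (ae_of_all _ fun ω => ?_)).trans (le_of_eq ?_))
  · have hq := abs_quad_le (f ω) (g ω) (h ω) (k ω)
    rw [abs_mul, abs_mul, abs_mul] at hq
    have hprod : |max (-R) (min R (f ω))| * |max (-R) (min R (g ω))| * |max (-R) (min R (h ω))| * |max (-R) (min R (k ω))| ≤
        |f ω| * |g ω| * |h ω| * |k ω| :=
      mul_le_mul (mul_le_mul (mul_le_mul (hshrink _) (hshrink _) (abs_nonneg _) (abs_nonneg _)) (hshrink _) (abs_nonneg _) (by positivity))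
        (hshrink _) (abs_nonneg _) (by positivity)
    have : |max (-R) (min R (f ω)) * max (-R) (min R (g ω)) * max (-R) (min R (h ω)) * max (-R) (min R (k ω))| ≤
        (f ω ^ 4 + g ω ^ 4 + h ω ^ 4 + k ω ^ 4) / 4 := by rw [abs_mul, abs_mul, abs_mul]; exact hprod.trans hq
    simpa using this
  · rw [integral_div, integral_add h4b hk4, integral_add h4a hh4, integral_add hf4 hg4]

/-- **The clamped triple moment**: `|∫T_RfT_RgT_Rh| ≤ (∫f² + (∫g⁴ + ∫h⁴)∕2)∕2` (`R ≥ 0`). [folklore] -/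
theorem abs_expect_clamped_triple_le [IsProbabilityMeasure μ] (hf : Measurable f) {R : ℝ} (hR : 0 ≤ R)
    (hf4 : Integrable (fun ω => f ω ^ 4) μ) (hg4 : Integrable (fun ω => g ω ^ 4) μ) (hh4 : Integrable (fun ω => h ω ^ 4) μ) :
    |∫ ω, max (-R) (min R (f ω)) * max (-R) (min R (g ω)) * max (-R) (min R (h ω)) ∂μ| ≤
      ((∫ ω, f ω ^ 2 ∂μ) + ((∫ ω, g ω ^ 4 ∂μ) + (∫ ω, h ω ^ 4 ∂μ)) / 2) / 2 := by
  have hshrink : ∀ w : ℝ, |max (-R) (min R w)| ≤ |w| := fun w => by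
    rcases le_or_gt w (-R) with h1 | h1
    · rw [min_eq_right (by linarith), max_eq_left h1, abs_of_nonpos (by linarith), abs_of_nonpos (by linarith)]; linarith
    · rcases le_or_gt w R with h2 | h2
      · rw [min_eq_right h2, max_eq_right h1.le]
      · rw [min_eq_left h2.le, max_eq_right (by linarith), abs_of_nonneg hR, abs_of_pos (by linarith)]; linarith
  have hf2 := integrable_sq_of_quartic hf hf4
  have hgh : Integrable (fun ω => (g ω ^ 4 + h ω ^ 4) / 2) μ := (hg4.add hh4).div_const 2
  have hb : Integrable (fun ω => (f ω ^ 2 + (g ω ^ 4 + h ω ^ 4) / 2) / 2) μ := (hf2.add hgh).div_const 2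
  refine (abs_integral_le_integral_abs).trans ((integral_mono_of_nonneg (ae_of_all _ fun ω => abs_nonneg _) hb
    (ae_of_all _ fun ω => ?_)).trans (le_of_eq ?_))
  · have hq := abs_triple_le' (f ω) (g ω) (h ω)
    rw [abs_mul, abs_mul] at hq
    have hprod : |max (-R) (min R (f ω))| * |max (-R) (min R (g ω))| * |max (-R) (min R (h ω))| ≤ |f ω| * |g ω| * |h ω| :=
      mul_le_mul (mul_le_mul (hshrink _) (hshrink _) (abs_nonneg _) (abs_nonneg _)) (hshrink _) (abs_nonneg _) (by positivity)
    have : |max (-R) (min R (f ω)) * max (-R) (min R (g ω)) * max (-R) (min R (h ω))| ≤ (f ω ^ 2 + (g ω ^ 4 + h ω ^ 4) / 2) / 2 := by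
      rw [abs_mul, abs_mul]; exact hprod.trans hq
    simpa using this
  · rw [integral_div, integral_add hf2 hgh, integral_div, integral_add hg4 hh4]

/-- **The pure triple defect in expectation**: `|∫fgh − ∫T_RfT_RgT_Rh| ≤ (∫f⁴ + ∫g⁴ + ∫h⁴)∕R` (`R > 0`). [folklore] -/
theorem triple_expect_defect_le [IsProbabilityMeasure μ] (hf : Measurable f) (hg : Measurable g) (hh : Measurable h) {R : ℝ} (hR : 0 < R)
    (hf4 : Integrable (fun ω => f ω ^ 4) μ) (hg4 : Integrable (fun ω => g ω ^ 4) μ) (hh4 : Integrable (fun ω => h ω ^ 4) μ) :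
    |(∫ ω, f ω * g ω * h ω ∂μ) - ∫ ω, max (-R) (min R (f ω)) * max (-R) (min R (g ω)) * max (-R) (min R (h ω)) ∂μ| ≤
      ((∫ ω, f ω ^ 4 ∂μ) + (∫ ω, g ω ^ 4 ∂μ) + (∫ ω, h ω ^ 4 ∂μ)) / R := by
  rw [← integral_sub (integrable_triple' hf hg hh hf4 hg4 hh4) (integrable_triple_clamped' hf hg hh hR.le hf4 hg4 hh4)]
  have h4a : Integrable (fun ω => f ω ^ 4 + g ω ^ 4) μ := hf4.add hg4
  have h4b : Integrable (fun ω => f ω ^ 4 + g ω ^ 4 + h ω ^ 4) μ := h4a.add hh4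
  have hb : Integrable (fun ω => (f ω ^ 4 + g ω ^ 4 + h ω ^ 4) / R) μ := h4b.div_const R
  have hdom : ∀ ω, |f ω * g ω * h ω - max (-R) (min R (f ω)) * max (-R) (min R (g ω)) * max (-R) (min R (h ω))| ≤
      (f ω ^ 4 + g ω ^ 4 + h ω ^ 4) / R := fun ω => by
    have h0 := triple_sub_clamp_triple_abs_le hR (f ω) (g ω) (h ω)
    have s1 := sq_mul_abs_two_le (f ω) (g ω) (h ω)
    have s2 := sq_mul_abs_two_le (g ω) (f ω) (h ω)
    have s3 := sq_mul_abs_two_le (h ω) (f ω) (g ω)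
    have e2 : |f ω| * g ω ^ 2 * |h ω| = g ω ^ 2 * |f ω| * |h ω| := by ring
    have e3 : |f ω| * |g ω| * h ω ^ 2 = h ω ^ 2 * |f ω| * |g ω| := by ring
    rw [e2, e3] at h0
    refine h0.trans (div_le_div_of_nonneg_right ?_ hR.le)
    linarith
  refine (abs_integral_le_integral_abs).trans ((integral_mono_of_nonneg (ae_of_all _ fun ω => abs_nonneg _) hb (ae_of_all _ hdom)).trans
    (le_of_eq ?_))
  rw [integral_div, integral_add h4a hh4, integral_add hf4 hg4]

/-! ## §3. Toy -/

/-- Toy (§1 at `x = y = z = 1`): `1 ≤ 1/2 + 2/4`. -/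
example : (1 : ℝ) ^ 2 * |(1 : ℝ)| * |(1 : ℝ)| ≤ 1 ^ 4 / 2 + (1 ^ 4 + 1 ^ 4) / 4 := sq_mul_abs_two_le 1 1 1

end Summit.QuantumFields.BalabanUV.T4Continuum.NE7b.SupTruncationFiveMoments

end
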